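import Mathlib.LinearAlgebra.Matrix.Trace
import Mathlib.LinearAlgebra.Matrix.Notation
import Mathlib.Analysis.SpecialFunctions.Trigonometric.Basic
import Mathlib.Tactic.FinCases
import Mathlib.Tactic.Ring
import Mathlib.Tactic.Linarith
import HarnessLib

/-!
# Free Euclidean Maxwell field on `ℝ⁴`: the curvature two-point kernel anticommutes with the Hodge star

The two-point function of the field strength `F_{μν} = ∂_μ A_ν − ∂_ν A_μ` of the free (massless,
Gaussian) Euclidean Maxwell field on `ℝ⁴` is, at non-coincident points and in any covariant gauge
(it is gauge independent),
`⟨F_{μν}(x) F_{ρσ}(0)⟩ = −(δ_{νσ} ∂_μ∂_ρ + δ_{μρ} ∂_ν∂_σ − δ_{νρ} ∂_μ∂_σ − δ_{μσ} ∂_ν∂_ρ) D(x)`,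
`D(x) = (4π² |x|²)⁻¹`, i.e. `(π² |x|⁴)⁻¹ (I_{μρ} I_{νσ} − I_{μσ} I_{νρ})` with the inversion tensor
`I_{μν}(x) = δ_{μν} − 2 x_μ x_ν / |x|²` — the conformal two-point function of a free antisymmetric
tensor of dimension `2` [Osborn–Petkou 1994, §2 (inversion tensor `I_{μν}`) and §6].  We record it as
an explicit rational function (`curvTwoPoint`; numerator polynomial `curvKernelNum`, the factor
`|x|⁶ ∂_μ∂_ρ |x|⁻² = −2 δ_{μρ}|x|² + 8 x_μ x_ρ` being `hessNum`) and, in the basis of the six coordinate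
2-planes `01, 02, 03, 12, 13, 23`, as the symmetric `6 × 6` matrix `curvMatrix x` (numerators).

**Main identity (electric–magnetic duality of the free Maxwell two-point function).** With `hodge`
the Hodge star on 2-forms of `ℝ⁴` (`⋆(dx^μ∧dx^ν) = ½ ε_{μνρσ} dx^ρ∧dx^σ`, an involution,
`hodge_mul_hodge`), the kernel ANTICOMMUTES with `⋆` at every `x`:
`curvMatrix x * hodge = -(hodge * curvMatrix x)` (`curvMatrix_mul_hodge`).  Equivalently the
self-dual/self-dual and anti-self-dual/anti-self-dual blocks vanish identically off the diagonal,
`⟨F⁺(x) F⁺(0)⟩ = 0 = ⟨F⁻(x) F⁻(0)⟩` (`selfDual_block_eq_zero`, `antiSelfDual_block_eq_zero`): all the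
correlation of the free photon field strength sits in `⟨F⁺ F⁻⟩` (in Minkowski language `F⁺` creates
one helicity and annihilates the other; duality rotations [Deser–Teitelboim 1976, §II] act on `F^±`
with opposite charges).  At pure time separation this is the familiar sign pattern forced by
reflection positivity, electric `⟨F_{0i}F_{0i}⟩ < 0 <` magnetic `⟨F_{ij}F_{ij}⟩` with EQUAL moduli
(`curvMatrix_time_axis`).

**Consequence recorded for the Yang–Mills statements of this tree (why it is here).** For a centred
Gaussian family of 2-form fields `F^a` (`a = 1, …, D` independent copies, e.g. `𝔤`-valued free
gluons) with this covariance, the `O(4)`-scalar Wick square `:F^a_{μν} F^a_{μν}: = Σ_a Σ_A (φ^a_A)²`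
(`A` running over the six planes, up to the factor `2`) has connected three-point function
`8 D · tr (K(x−y) K(y−z) K(z−x))` at non-coincident points (Wick/Isserlis), and by the anticommutation
every trace of a product of an ODD number of kernels vanishes (`trace_mul_mul_eq_zero_of_anticommute`,
`trace_curvMatrix_mul_mul`): the Wick square of the FREE curvature in the hypercubic-scalar channel
`tr F_{μν}F_{μν}` has identically vanishing connected three-point function on `⁰𝒮`, while its
truncated two-point function does not vanish (`trace_curvMatrix_mul_self`, `= 96 |x|⁴` for the
numerators).  Hence a Gaussian (spin-wave / over-cooled `β_k → ∞` / asymptotically free short-distance)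
scaling limit of the Wilson action density can never witness `OSData.IsNonGaussian` for the curvature
species `LatticeRep.curvature` (`YangMillsOS.lean`), contrary to what the parenthesis "the Wick square
of a free field passes it" in the docstring of `OSData.IsNonGaussian` suggests for THIS composite
(it is true for the Wick square of a free scalar, or of a single plaquette orientation `F_{01}²`).

Design: pure algebra over `ℝ` (explicit polynomials, `Matrix (Fin 6) (Fin 6) ℝ`); the identification of
`hessNum / |x|⁶` with the Hessian of `|x|⁻²` and the Wick/Isserlis combinatorics are stated in
docstrings only (no Gaussian measure is built here; see `CurvatureGaussianField.lean` for the lattice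
curvature Gaussian field and `GaussianFieldOfCovariance.lean` for continuum Gaussian fields).
-/

noncomputable section

namespace Literature.MathematicalPhysics.QuantumFieldTheory

namespace FreeMaxwell

open Matrix

/-- First index `μ` of the `a`-th coordinate 2-plane `μ < ν` of `ℝ⁴`, planes ordered
`01, 02, 03, 12, 13, 23`. [folklore] -/
def planeFst : Fin 6 → Fin 4 := ![0, 0, 0, 1, 1, 2]

/-- Second index `ν` of the `a`-th coordinate 2-plane `μ < ν` of `ℝ⁴`, planes ordered
`01, 02, 03, 12, 13, 23`. [folklore] -/
def planeSnd : Fin 6 → Fin 4 := ![1, 2, 3, 2, 3, 3]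

/-- `|x|⁶ ∂_μ ∂_ρ |x|⁻² = −2 δ_{μρ} |x|² + 8 x_μ x_ρ`: the numerator of the Hessian of the massless
scalar propagator `D(x) = (4π²|x|²)⁻¹` on `ℝ⁴` (up to `4π²`). [folklore] -/
def hessNum (x : Fin 4 → ℝ) (μ ρ : Fin 4) : ℝ :=
  -2 * (if μ = ρ then 1 else 0) * (x 0 ^ 2 + x 1 ^ 2 + x 2 ^ 2 + x 3 ^ 2) + 8 * x μ * x ρ

/-- Numerator polynomial of the free Maxwell curvature two-point function on `ℝ⁴`:
`4π² |x|⁶ ⟨F_{μν}(x) F_{ρσ}(0)⟩ = −(δ_{νσ} h_{μρ} + δ_{μρ} h_{νσ} − δ_{νρ} h_{μσ} − δ_{μσ} h_{νρ})`,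
`h = hessNum x`, obtained from `F = dA` and `⟨A_ν(x) A_σ(0)⟩ = δ_{νσ} D(x)` (Feynman gauge; the
result is gauge independent). [cite: OsbornPetkou1994, §2 and §6] -/
def curvKernelNum (x : Fin 4 → ℝ) (μ ν ρ σ : Fin 4) : ℝ :=
  -((if ν = σ then 1 else 0) * hessNum x μ ρ + (if μ = ρ then 1 else 0) * hessNum x ν σ
    - (if ν = ρ then 1 else 0) * hessNum x μ σ - (if μ = σ then 1 else 0) * hessNum x ν ρ)

/-- **The free Euclidean Maxwell curvature two-point function** on `ℝ⁴` at separation `x ≠ 0`: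
`⟨F_{μν}(x) F_{ρσ}(0)⟩ = (4π²)⁻¹ |x|⁻⁶ · curvKernelNum x μ ν ρ σ
 = (π²|x|⁴)⁻¹ (I_{μρ}I_{νσ} − I_{μσ}I_{νρ})`, `I_{μν} = δ_{μν} − 2x_μx_ν/|x|²`
(value `0` at `x = 0` by the `0⁻¹ = 0` convention; only `x ≠ 0` is meaningful). [cite: OsbornPetkou1994, §6] -/
def curvTwoPoint (x : Fin 4 → ℝ) (μ ν ρ σ : Fin 4) : ℝ :=
  (4 * Real.pi ^ 2)⁻¹ * ((x 0 ^ 2 + x 1 ^ 2 + x 2 ^ 2 + x 3 ^ 2) ^ 3)⁻¹ * curvKernelNum x μ ν ρ σ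

/-- The curvature two-point numerators as a `6 × 6` matrix in the basis of coordinate 2-planes
`01, 02, 03, 12, 13, 23`: `(curvMatrix x)_{ab} = curvKernelNum x μ_a ν_a μ_b ν_b`. [folklore] -/
def curvMatrix (x : Fin 4 → ℝ) : Matrix (Fin 6) (Fin 6) ℝ :=
  Matrix.of fun a b => curvKernelNum x (planeFst a) (planeSnd a) (planeFst b) (planeSnd b)

/-- **The Hodge star on 2-forms of `ℝ⁴`** in the plane basis `01, 02, 03, 12, 13, 23`:
`(⋆F)_{μν} = ½ ε_{μνρσ} F_{ρσ}`, i.e. `⋆e_{01} = e_{23}`, `⋆e_{02} = −e_{13}`, `⋆e_{03} = e_{12}` and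
symmetrically (`ε_{0123} = 1`): the `a`-th plane is paired with the `(5−a)`-th, with sign `−1` exactly for
the planes `02`, `13`. [folklore] -/
def hodge : Matrix (Fin 6) (Fin 6) ℝ :=
  Matrix.of fun a b => if a.val + b.val = 5 then (if a.val = 1 ∨ a.val = 4 then -1 else 1) else 0

/-- The Hodge star on 2-forms of `ℝ⁴` is an involution, `⋆⋆ = 1`. [folklore] -/
theorem hodge_mul_hodge : hodge * hodge = 1 := by
  ext a b
  fin_cases a <;> fin_cases b <;>
    simp [hodge, Matrix.mul_apply, Fin.sum_univ_six]

/-- The Hodge star matrix is symmetric. [folklore] -/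
theorem hodge_transpose : hodgeᵀ = hodge := by
  ext a b
  fin_cases a <;> fin_cases b <;> simp [hodge, Matrix.transpose_apply]

/-- The curvature kernel matrix is symmetric, `K(x)ᵀ = K(x)` (the field is bosonic and the kernel is
even). [folklore] -/
theorem curvMatrix_transpose (x : Fin 4 → ℝ) : (curvMatrix x)ᵀ = curvMatrix x := by
  ext a b
  fin_cases a <;> fin_cases b <;>
    simp [curvMatrix, curvKernelNum, hessNum, planeFst, planeSnd, Matrix.transpose_apply] <;> ring

/-- The curvature kernel is even, `K(−x) = K(x)`. [folklore] -/
theorem curvMatrix_neg (x : Fin 4 → ℝ) : curvMatrix (-x) = curvMatrix x := by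
  ext a b
  simp only [curvMatrix, Matrix.of_apply, curvKernelNum, hessNum, Pi.neg_apply]
  ring

/-- **Electric–magnetic duality of the free Maxwell two-point function**: the curvature kernel
anticommutes with the Hodge star, `K(x) ⋆ = −⋆ K(x)` for every `x ∈ ℝ⁴` (36 polynomial identities).
[cite: DeserTeitelboim1976, §II] -/
theorem curvMatrix_mul_hodge (x : Fin 4 → ℝ) :
    curvMatrix x * hodge = -(hodge * curvMatrix x) := by
  ext a b
  fin_cases a <;> fin_cases b <;>
    simp [curvMatrix, hodge, curvKernelNum, hessNum, planeFst, planeSnd, Matrix.mul_apply,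
      Fin.sum_univ_six] <;> ring

/-- `⋆ K(x) = −K(x) ⋆` (the anticommutation read from the left). [cite: DeserTeitelboim1976, §II] -/
theorem hodge_mul_curvMatrix (x : Fin 4 → ℝ) :
    hodge * curvMatrix x = -(curvMatrix x * hodge) := by
  rw [curvMatrix_mul_hodge, neg_neg]

/-- **The self-dual/self-dual block vanishes**: `(1 + ⋆) K(x) (1 + ⋆) = 0`, i.e.
`⟨F⁺_{μν}(x) F⁺_{ρσ}(0)⟩ = 0` for `x ≠ 0`, `F⁺ = ½(F + ⋆F)`. [cite: DeserTeitelboim1976, §II] -/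
theorem selfDual_block_eq_zero (x : Fin 4 → ℝ) :
    (1 + hodge) * curvMatrix x * (1 + hodge) = 0 := by
  have h1 := curvMatrix_mul_hodge x
  have h2 : hodge * curvMatrix x * hodge = -curvMatrix x := by
    rw [Matrix.mul_assoc, h1, Matrix.mul_neg, ← Matrix.mul_assoc, hodge_mul_hodge, Matrix.one_mul]
  have h3 : (1 + hodge) * curvMatrix x * (1 + hodge) =
      curvMatrix x + curvMatrix x * hodge + (hodge * curvMatrix x + hodge * curvMatrix x * hodge) := by
    simp only [Matrix.add_mul, Matrix.mul_add, Matrix.one_mul, Matrix.mul_one]; abel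
  rw [h3, h1, h2]
  abel

/-- **The anti-self-dual/anti-self-dual block vanishes**: `(1 − ⋆) K(x) (1 − ⋆) = 0`, i.e.
`⟨F⁻_{μν}(x) F⁻_{ρσ}(0)⟩ = 0` for `x ≠ 0`. [cite: DeserTeitelboim1976, §II] -/
theorem antiSelfDual_block_eq_zero (x : Fin 4 → ℝ) :
    (1 - hodge) * curvMatrix x * (1 - hodge) = 0 := by
  have h1 := curvMatrix_mul_hodge x
  have h2 : hodge * curvMatrix x * hodge = -curvMatrix x := by
    rw [Matrix.mul_assoc, h1, Matrix.mul_neg, ← Matrix.mul_assoc, hodge_mul_hodge, Matrix.one_mul]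
  have h3 : (1 - hodge) * curvMatrix x * (1 - hodge) =
      curvMatrix x - curvMatrix x * hodge - (hodge * curvMatrix x - hodge * curvMatrix x * hodge) := by
    simp only [Matrix.sub_mul, Matrix.mul_sub, Matrix.one_mul, Matrix.mul_one]; abel
  rw [h3, h1, h2]
  abel

/-- At pure time separation `x = t e₀` the kernel is diagonal in the plane basis with
electric entries `−4t²` (planes `0i`) and magnetic entries `+4t²` (planes `ij`): equal moduli, opposite
signs (the electric sign is the one reflection positivity forces). [folklore] -/
theorem curvMatrix_time_axis (t : ℝ) :
    curvMatrix ![t, 0, 0, 0] =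
      Matrix.diagonal ![-4 * t ^ 2, -4 * t ^ 2, -4 * t ^ 2, 4 * t ^ 2, 4 * t ^ 2, 4 * t ^ 2] := by
  ext a b
  fin_cases a <;> fin_cases b <;>
    simp [curvMatrix, curvKernelNum, hessNum, planeFst, planeSnd] <;> ring

/-- **Odd traces vanish for operators anticommuting with an involution**: if `J² = 1` and
`A J = −J A`, `B J = −J B`, `C J = −J C` then `tr (A B C) = 0` (conjugating by `J` flips the sign of
the product while preserving the trace). [folklore] -/
theorem trace_mul_mul_eq_zero_of_anticommute {n : Type*} [Fintype n] [DecidableEq n]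
    {J A B C : Matrix n n ℝ} (hJ : J * J = 1) (hA : A * J = -(J * A)) (hB : B * J = -(J * B))
    (hC : C * J = -(J * C)) : Matrix.trace (A * B * C) = 0 := by
  have hconj : J * (A * B * C) * J = -(A * B * C) := by
    have hA' : J * A = -(A * J) := by rw [hA, neg_neg]
    have hB' : J * B = -(B * J) := by rw [hB, neg_neg]
    have hC' : J * C = -(C * J) := by rw [hC, neg_neg]
    calc J * (A * B * C) * J = ((J * A) * B) * C * J := by simp only [Matrix.mul_assoc]
      _ = -(A * (J * B) * C * J) := by
          rw [hA']; simp only [Matrix.neg_mul, Matrix.mul_assoc]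
      _ = A * (B * (J * C)) * J := by
          rw [hB']; simp only [Matrix.neg_mul, Matrix.mul_neg, neg_neg, Matrix.mul_assoc]
      _ = -(A * B * C * (J * J)) := by
          rw [hC']; simp only [Matrix.neg_mul, Matrix.mul_neg, Matrix.mul_assoc]
      _ = -(A * B * C) := by rw [hJ, Matrix.mul_one]
  have htr : Matrix.trace (J * (A * B * C) * J) = Matrix.trace (A * B * C) := by
    rw [Matrix.trace_mul_cycle, hJ, Matrix.one_mul]
  rw [hconj, Matrix.trace_neg] at htr
  linarith

/-- **Vanishing of the cubic Wick trace of the free curvature**: for all `x, y, z ∈ ℝ⁴`,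
`tr (K(x) K(y) K(z)) = 0`.  With `x, y, z` the three difference vectors of a triangle this is (up to the
positive factors `(4π²|·|⁶)⁻¹` and `8 · #colours`) the connected three-point function of the
`O(4)`-scalar Wick square `:F_{μν}F_{μν}:` of the free Maxwell field at non-coincident points, which
therefore vanishes identically. [folklore] -/
theorem trace_curvMatrix_mul_mul (x y z : Fin 4 → ℝ) :
    Matrix.trace (curvMatrix x * curvMatrix y * curvMatrix z) = 0 :=
  trace_mul_mul_eq_zero_of_anticommute hodge_mul_hodge (curvMatrix_mul_hodge x)
    (curvMatrix_mul_hodge y) (curvMatrix_mul_hodge z)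

/-- The quadratic Wick trace does NOT vanish: `tr (K(x) K(x)) = 96 |x|⁴` (so, `K` being even, the
truncated two-point function of the Wick square `:F_{μν}F_{μν}:`, `∝ tr (K(x−y) K(y−x))`, is nonzero at
every pair of distinct points — the obstruction above is specific to odd orders). [folklore] -/
theorem trace_curvMatrix_mul_self (x : Fin 4 → ℝ) :
    Matrix.trace (curvMatrix x * curvMatrix x) = 96 * (x 0 ^ 2 + x 1 ^ 2 + x 2 ^ 2 + x 3 ^ 2) ^ 2 := by
  simp [Matrix.trace, Matrix.mul_apply, Fin.sum_univ_six, curvMatrix, curvKernelNum, hessNum,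
    planeFst, planeSnd]
  ring

end FreeMaxwell

end Literature.MathematicalPhysics.QuantumFieldTheory

end
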